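import Mathlib
import HarnessLib
import Summits.ValiantsHypothesis.ValiantsHypothesis.Theses.MonotoneRestoration
import Literature.Computability.AlgebraicComplexity.ArithCircuit
import Literature.Computability.AlgebraicComplexity.ArithCircuitProofs
import Literature.Computability.AlgebraicComplexity.MonotoneStructure
import Literature.Computability.AlgebraicComplexity.PermanentIrreducible
import Literature.ModelTheory.FiniteModelTheory.CkEquiv
import Summits.ValiantsHypothesis.ValiantsHypothesis.Theorems.MonotoneRestorationMonotoneRestorationQPCosetCount
import Summits.ValiantsHypothesis.ValiantsHypothesis.Theorems.MonotoneRestorationMonotoneRestorationQPSymmetricLB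
import Summits.ValiantsHypothesis.ValiantsHypothesis.Theorems.MonotoneRestorationMonotoneRestorationQPSupportSymmetrisation
import Summits.ValiantsHypothesis.ValiantsHypothesis.Theorems.MonotoneRestorationMonotoneRestorationQPSparseRegime
import Summits.ValiantsHypothesis.ValiantsHypothesis.Theorems.MonotoneRestorationMonotoneRestorationQPBeta
import Literature.Computability.AlgebraicComplexity.SymmetricArithCircuit
import Literature.Computability.AlgebraicComplexity.DawarWilsenach2025Proofs
import Literature.GroupTheory.PermutationGroups.SmallIndexSubgroups
import Summits.ValiantsHypothesis.ValiantsHypothesis.Theorems.MonotoneRestorationQP.Negative.LoadBearing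
import Summits.ValiantsHypothesis.ValiantsHypothesis.Theorems.MonotoneRestorationMonotoneRestorationQPPermSupportCount
import Summits.ValiantsHypothesis.ValiantsHypothesis.Theorems.MonotoneRestorationMonotoneRestorationQPVariants18934Neg

/-! TTRL-lite variant V18957 of stmt-ValiantsHypothesis-15886 -/

-- `Summit.ValiantsHypothesis.ValiantsHypothesis.…` is the tree's mandated single-conjunct layout
-- (Sub = Summit), so the duplicated namespace component is intended.
set_option linter.dupNamespace false

namespace Summit.ValiantsHypothesis.ValiantsHypothesis.Theorems

open Summit.ValiantsHypothesis.ValiantsHypothesis.Theses.MonotoneRestoration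
open Literature.Computability.AlgebraicComplexity

/-- **TTRL-lite variant V18957** (`generalise`: coefficients in `ℤ` instead of `ℝ≥0`, arbitrary
number `n` of row/column indices) of `stub_mulGate_children_extend`
(item `stmt-ValiantsHypothesis-15886`) is FALSE: with signed coefficients a product can cancel
monomials, so a common shift of the product's support into `f.support` need not restrict to a
shift of a factor's support.  The statement quantifies over all `n`, so it fails already at
`n = 1`, where it is literally the refuted variant V18934
(`stub_mulGate_children_extend_var18934_false`): one variable `v = (0, 0)`, `p = 1 + X v`,
`q = 1 - X v`, `f = p * q = 1 - X v ^ 2`; the hypothesis holds with `μ = 0`, but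
`p.support = {0, v}` while every monomial of `f` has `v`-degree `0` or `2`, so no shift `μ` puts
both `μ` and `v + μ` in `f.support`.  Monotonicity (`ℝ≥0`, no cancellation) is load-bearing for
the stub. [folklore] -/
theorem stub_mulGate_children_extend_var18957_false :
    ¬ (∀ (n : ℕ) (p q f : MvPolynomial (Fin n × Fin n) ℤ), p * q ≠ 0 →
        (∃ μ : (Fin n × Fin n) →₀ ℕ, ∀ m ∈ (p * q).support, m + μ ∈ f.support) →
        ∃ μ : (Fin n × Fin n) →₀ ℕ, ∀ m ∈ p.support, m + μ ∈ f.support) :=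
  fun h => stub_mulGate_children_extend_var18934_false (h 1)

end Summit.ValiantsHypothesis.ValiantsHypothesis.Theorems
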